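import Summits.ResolutionOfSingularities.ResolutionOfSingularities.Theorems.WildQuotientsWildQuotientResolutionBlowupExitSingularLocusRestrict
import Summits.ResolutionOfSingularities.ResolutionOfSingularities.Theorems.FrobeniusLadderFRationalResolutionFixedStratumAffineCentre
import Literature.AlgebraicGeometry.Resolution.MarkedIdealsEtale
import Mathlib.AlgebraicGeometry.PullbackCarrier
import HarnessLib

/-!
# Crux `FrobeniusLadder.FRationalResolution` (stmt-ResolutionOfSingularities-15317), line `redirect`,
# stub `stub_diagonalizableQuotientResolution` — **the intrinsic blow-up `Bl_{𝓘_{Sing X}} X` read through an étale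
# roof** (design C3 = the rank-2 stratum layer of the non-isolated case, scheme-level global round L3-b: the
# canonical centre needs no gluing, so ONE ring-level description of the singular locus on a chart controls the
# global blow-up over the whole chart)

DATA: `f : X → Spec k` locally of finite type, `π : X₁ → X` ANY blowing up of `X` along the reduced singular locus
`𝓘_{Sing X}` (`singularLocusIdeal X f`), and an ÉTALE ROOF `X ←ρ— Y —j↪ Spec R` (`ρ` étale, `j` an open immersion)
together with a radical ideal `J ⊆ R` cutting out the singular locus ON THE IMAGE OF `Y`.

* `idealSheaf_comap_eq_singularLocusIdeal` — then `j^* J̃ = 𝓘_{Sing Y}`: the pulled-back centre is the intrinsic one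
  (pointwise hypothesis `¬ IsRegularLocalRing R_{j y} ↔ J ⊆ j y` on `Y` only; `J` radical);
* **`exists_roof_pullback`** — hence `Y₁ := X₁ ×_X Y` is at the same time `Bl_{𝓘_{Sing Y}} Y` (blow-ups commute with
  the étale base change `ρ`, `BlowupExit.isBlowup_pullback_snd_singularLocusIdeal_of_etale`) and
  `Y ×_{Spec R} Bl_J(Spec R)` (flat base change along `j`, `IsBlowup.pullback_snd_of_flat` + `IsBlowup.unique`): there
  are an ÉTALE `Φ₁ : Y₁ → X₁` and an OPEN IMMERSION `Φ₂ : Y₁ → affineBlowup J` over the roof, regularity of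
  `𝒪_{X₁, Φ₁ y₁}` is equivalent to regularity of `𝒪_{Bl_J, Φ₂ y₁}`, and every point of `X₁` over a point of `ρ(Y)` is
  hit by `Φ₁` — so the points of the GLOBAL blow-up over `x = ρ y` are classified by the points of `affineBlowup J`
  over `j y` (lineage 2's `…FixedStratumBlowupPointsChain`).

Honest label: scheme plumbing toward ONE leaf stub (no stub, crux or summit closed). No definitions, no named facts,
no sorry. [cite: GortzWedhorn2020, Prop. 13.91 (2), (13.19) p. 413] [cite: Liu2002, §8.3.4, (3.11)]
[cite: Matsumura1987, Thm. 23.7]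
-/

noncomputable section

-- single-problem summit: the doubled namespace component is forced
set_option linter.dupNamespace false

open CategoryTheory CategoryTheory.Limits AlgebraicGeometry TopologicalSpace
open AlgebraicGeometry.Scheme.IdealSheafData
open Literature.AlgebraicGeometry.Resolution Literature.AlgebraicGeometry.CossartJannsenSaito2020
open Summit.ResolutionOfSingularities.ResolutionOfSingularities.Theorems.WildQuotientResolution
open Summit.ResolutionOfSingularities.ResolutionOfSingularities.Theorems.FRationalResolution

namespace Summit.ResolutionOfSingularities.ResolutionOfSingularities.Theorems.FRationalResolution.SingBlowupRoofPullback

/-- **On the image of an open immersion `j : Y ↪ Spec R`, a radical ideal `J` cutting out the singular locus pulls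
back to the intrinsic centre: `j^* J̃ = 𝓘_{Sing Y}`.** The hypothesis is pointwise on `Y` only
(`¬ IsRegularLocalRing R_{j y} ↔ J ⊆ j y`). [cite: Liu2002, §8.3.4, (3.11)] [cite: GortzWedhorn2020, Prop. 13.91 (2)] -/
theorem idealSheaf_comap_eq_singularLocusIdeal {k : Type} [Field k] {Y : Scheme.{0}} (g : Y ⟶ Spec (.of k))
    [LocallyOfFiniteType g] {R : Type} [CommRing R] (j : Y ⟶ Spec (.of R)) [IsOpenImmersion j]
    (J : Ideal R) (hJ : J.IsRadical)
    (hZ : ∀ y : Y, ¬ IsRegularLocalRing (Localization.AtPrime (j y).asIdeal) ↔ J ≤ (j y).asIdeal) :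
    (affineBlowup.idealSheaf J).comap j = singularLocusIdeal Y g := by
  rw [← FixedStratumAffineCentre.vanishingIdeal_zeroLocus_eq_idealSheaf_of_isRadical J hJ,
    comap_vanishingIdeal_eq_of_flat_of_isPreimmersion, singularLocusIdeal]
  congr 1
  apply Closeds.ext
  rw [Closeds.coe_preimage, Closeds.coe_mk, coe_singularLocusClosed]
  ext y
  change (J : Set R) ⊆ (j y).asIdeal ↔ y ∉ Scheme.regularLocus Y
  rw [SetLike.coe_subset_coe, ← hZ y, mem_regularLocus_iff_of_flat_of_isPreimmersion j y, regularLocus_Spec_eq]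
  rfl

set_option maxHeartbeats 400000 in
/-- **The intrinsic blow-up through an étale roof.** For `π : X₁ → X` a blowing up along `𝓘_{Sing X}`, an étale roof
`X ←ρ— Y —j↪ Spec R` and a radical `J ⊆ R` cutting out the singular locus on `j(Y)`: `Y₁ := X₁ ×_X Y` carries an étale
`Φ₁ : Y₁ → X₁` and an open immersion `Φ₂ : Y₁ → Bl_J(Spec R)` over the roof (`Φ₁ ≫ π = ρ₁ ≫ ρ`,
`Φ₂ ≫ π_J = ρ₁ ≫ j`), regularity at `Φ₁ y₁` and at `Φ₂ y₁` are equivalent, and every point of `X₁` over `ρ y` is some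
`Φ₁ y₁` with `ρ₁ y₁ = y`. [cite: GortzWedhorn2020, Prop. 13.91 (2), (13.19) p. 413] [cite: Matsumura1987, Thm. 23.7] -/
theorem exists_roof_pullback {k : Type} [Field k] {X X₁ Y : Scheme.{0}} (f : X ⟶ Spec (.of k))
    [LocallyOfFiniteType f] {π : X₁ ⟶ X} (hπ : IsBlowup π (singularLocusIdeal X f))
    (ρ : Y ⟶ X) [Etale ρ] {R : Type} [CommRing R] [IsNoetherianRing R] (j : Y ⟶ Spec (.of R))
    [IsOpenImmersion j] (J : Ideal R) (hJ : J.IsRadical)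
    (hZ : ∀ y : Y, ¬ IsRegularLocalRing (Localization.AtPrime (j y).asIdeal) ↔ J ≤ (j y).asIdeal) :
    ∃ (Y₁ : Scheme.{0}) (Φ₁ : Y₁ ⟶ X₁) (_ : Etale Φ₁) (Φ₂ : Y₁ ⟶ affineBlowup J) (_ : IsOpenImmersion Φ₂)
      (ρ₁ : Y₁ ⟶ Y), Φ₁ ≫ π = ρ₁ ≫ ρ ∧ Φ₂ ≫ affineBlowup.π J = ρ₁ ≫ j ∧
      (∀ y₁ : Y₁, IsRegularLocalRing (X₁.presheaf.stalk (Φ₁ y₁)) ↔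
        IsRegularLocalRing ((affineBlowup J).presheaf.stalk (Φ₂ y₁))) ∧
      ∀ (x₁ : X₁) (y : Y), π x₁ = ρ y → ∃ y₁ : Y₁, Φ₁ y₁ = x₁ ∧ ρ₁ y₁ = y := by
  haveI : IsLocallyNoetherian X := LocallyOfFiniteType.isLocallyNoetherian f
  haveI : IsProper π := hπ.isProper
  haveI : LocallyOfFiniteType (ρ ≫ f) := inferInstance
  haveI : IsLocallyNoetherian X₁ := LocallyOfFiniteType.isLocallyNoetherian (π ≫ f)
  haveI : IsLocallyNoetherian (affineBlowup J) := LocallyOfFiniteType.isLocallyNoetherian (affineBlowup.π J)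
  -- `Y₁ := X₁ ×_X Y → Y` is a blow-up along `𝓘_{Sing Y}` (étale base change)
  have h₁ : IsBlowup (pullback.snd π ρ) (singularLocusIdeal Y (ρ ≫ f)) :=
    BlowupExit.isBlowup_pullback_snd_singularLocusIdeal_of_etale f hπ ρ
  -- `Bl_J(Spec R) ×_{Spec R} Y → Y` is a blow-up along `j^* J̃ = 𝓘_{Sing Y}` (flat base change)
  have h₂ : IsBlowup (pullback.snd (affineBlowup.π J) j) (singularLocusIdeal Y (ρ ≫ f)) := by
    rw [← idealSheaf_comap_eq_singularLocusIdeal (ρ ≫ f) j J hJ hZ]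
    exact (affineBlowup.isBlowup J).pullback_snd_of_flat j
  obtain ⟨e, he, he'⟩ := h₁.unique h₂
  haveI : IsLocallyNoetherian (pullback π ρ) :=
    LocallyOfFiniteType.isLocallyNoetherian (pullback.fst π ρ ≫ π ≫ f)
  refine ⟨pullback π ρ, pullback.fst π ρ, inferInstance, e.hom ≫ pullback.fst (affineBlowup.π J) j, inferInstance,
    pullback.snd π ρ, pullback.condition, ?_, fun y₁ => ?_, fun x₁ y hxy => ?_⟩
  · rw [Category.assoc, pullback.condition, ← Category.assoc, he]
  · rw [← isRegularLocalRing_stalk_iff_of_etale (pullback.fst π ρ) y₁]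
    have h := mem_regularLocus_iff_of_flat_of_isPreimmersion (e.hom ≫ pullback.fst (affineBlowup.π J) j) y₁
    simp only [Scheme.mem_regularLocus] at h
    exact h
  · obtain ⟨w, hw1, hw2⟩ := Scheme.Pullback.exists_preimage_pullback (f := π) (g := ρ) x₁ y hxy
    exact ⟨w, hw1, hw2⟩

end Summit.ResolutionOfSingularities.ResolutionOfSingularities.Theorems.FRationalResolution.SingBlowupRoofPullback

end
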